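import Mathlib.Analysis.SpecialFunctions.Gamma.Basic
import Literature.Analysis.FluidPDE.ClassicalSolution
import Literature.Analysis.FunctionSpaces.HolderNorm
import HarnessLib

/-!
# Córdoba–Martínez-Zoroa–Zheng: finite-time blow-up for the FORCED HYPODISSIPATIVE Navier–Stokes
# equations on `ℝ³` (dissipation `ν|∇|^α`, `0 ≤ α < (22 − 8√7)/9 ≈ 0.0928`)

Topic `Literature/Analysis/FluidPDE`. Statements file (ONE NAMED FACT with cite tag; the notions it
needs are definitions with bodies; small API proved). Source: `[CordobaMartinezzoroaZheng2024]`
D. Córdoba, L. Martínez-Zoroa, F. Zheng, *Finite time blow-up for the hypodissipative Navier Stokes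
equations with a force in `L¹_t C^{1,ε}_x ∩ L^∞_t L²_x`*, arXiv:2407.06776, published Arch. Ration.
Mech. Anal. (2026) doi:10.1007/s00205-026-02198-0 ("p." = PDF page of the held arXiv text
`paper:arxiv-2407.06776`).

WHAT THIS IS (and is not): the only rigorous finite-time singularity in the `C^{1,α}`-Euler family
of constructions (Elgindi; Elgindi–Ghoul–Masmoudi; Córdoba–Martínez-Zoroa–Zheng 2023;
Córdoba–Martínez-Zoroa 2023) that survives a DISSIPATIVE term — but the dissipation is the
fractional `ν|∇|^α = ν(−Δ)^{α/2}` of order `α < 0.093` (the Navier–Stokes Laplacian is `α = 2`), the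
system is FORCED with a force only in `L¹_t C^{1,ε}_x ∩ L^∞_t L²_x` (not smooth, not decaying: not
a Clay-class force), and the solutions are NOT axisymmetric (the vortex-layer cascade of the forced
Euler construction, §1.2.3 p. 5). Nothing here is a statement about the Navier–Stokes equations.

## The printed statement (p. 1–2)

Equation (1), p. 1: "`uₜ + u·∇u + ∇P + ν|∇|^α u = f`, `∇·u = 0`, `(x,t) ∈ ℝ³ × ℝ₊`", "`|∇|^α g ≡
(−Δ)^{α/2} g` the Fourier multiplier `(|∇|^α g)^(ξ) = |ξ|^α ĝ(ξ)`"; `0 < α < 2` "hypodissipative",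
`α = 2` Navier–Stokes, `ν = 0` Euler. **Theorem 1** (p. 2): "There is `α₀ = (22 − 8√7)/9 > 0` such
that for any `α ∈ [0, α₀)`, there exist solutions of the forced 3D incompressible fractional
Navier–Stokes equations (1) in `ℝ³ × [0, 1]` with `ν > 0`¹ and an external forcing which is in
`L¹_t([0,1]) C^{1,ε}_x ∩ L^∞_t L²_x` for some `ε > 0`, such that the velocity
`u ∈ L^∞_{t,x} ∩ L^∞_t L²_x`, and that on the time interval `0 ≤ t < 1`, the velocity `u` is smooth
in `x` and satisfies `lim_{t→1} ∫₀ᵗ |∇u(x,s)|_{L^∞} ds = ∞`." Footnote 1: "We will actually show the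
theorem for `ν = 0.01`, but a rescaling argument shows the result for all `ν > 0`." Remark 1: local
existence holds in these classes. §4.3 p. 27: the vorticity is `ω = Σ ρₙ(t) ωₙ` with smooth time
cut-offs `ρₙ` supported on `[Tₙ, 1]`, `1 − Tₙ → 0`, "on any compact subset of `[0, 1)`, only
finitely many `ωₙ` is non-zero, so the whole sum is smooth in `(x,t) ∈ ℝ³ × [0, 1)`", and the force
is the residual of the equation (p. 28).

## Rendering

* `fracDeriv α v x = c_{3,α/2} ∫ (v x − v y) ‖x − y‖^{−(3+α)} dy` — the hypersingular-integral form of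
  `|∇|^α = (−Δ)^{α/2}` on `ℝ³` [cite: DinezzaPalatucciValdinoci2012, §3 eq. (3.1)–(3.2) and Prop. 3.3
  (Fourier symbol |ξ|^{2s}, s = α/2)], with the normalising constant
  `c_{3,s} = s 4^s Γ(3/2 + s) / (π^{3/2} Γ(1 − s))` (`fracDerivConst`). For `0 < α < 1` and `v`
  bounded and Lipschitz the integral converges absolutely (no principal value): this covers the
  theorem's smooth bounded slices and its range `α < α₀ < 1`. Since the theorem quantifies over ALL
  `ν > 0`, the rendered statement is insensitive to the (positive) normalisation of the operator and
  to the Fourier convention behind "`|ξ|^α`".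
* `IsClassicalFracNSSolutionOn S ν α f u P`: the four fields of the tree's
  `IsClassicalNSSolutionOn` (`ClassicalSolution.lean`) with `νΔu` replaced by `−ν|∇|^α u`, except that
  the pressure is only asked to be `C¹` in space on each slice (the source prints nothing about the
  pressure): `u` jointly `C^∞` on `S × ℝ³` (§4.3 p. 27), momentum equation pointwise with the one-sided
  time derivative `timeDerivWithin S`, `div u = 0`.
* `CordobaMartinezZoroaZheng2024.hypodissipativeForcedBlowup` — Theorem 1 for `0 < α < α₀` (the
  endpoint `α = 0`, the damped Euler case `ν|∇|⁰ = ν·id`, is printed but not rendered: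
  `-- TODO(general form): α = 0`): for every such `α` and every `ν > 0` there are `ε > 0` and
  `(u, P, f)` on `[0, 1) × ℝ³` with `IsClassicalFracNSSolutionOn (Ico 0 1) ν α f u P`, force
  `∫_{[0,1)} ‖f(t)‖_{C^{1,ε}} dt < ∞` and `sup_{t<1} ∫|f(t)|² < ∞`, velocity `sup_{t<1,x} |u| < ∞` and
  `sup_{t<1} ∫|u(t)|² < ∞`, and `∫₀ᵗ ‖∇u(s)‖_{L^∞} ds → ∞` as `t ↑ 1` (`‖∇u(s)‖_{L^∞}` = the tree's
  `eSupNorm` of the Fréchet derivative `x ↦ Du(s)(x)`, operator norm).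
* Proved: unfolding lemmas, `fracDeriv` of a constant field vanishes, `0 < α₀ < 1`, and the
  consequence that `‖∇u(t)‖_{L^∞}` is unbounded on `[0,1)` (`gradient_unbounded`).
-/

noncomputable section

open MeasureTheory Set Function Filter
open _root_.Topology
open scoped NNReal ENNReal ContDiff Real

namespace Literature.Analysis.FluidPDE

/-! ### The fractional derivative `|∇|^α` on `ℝ³` in hypersingular form -/

section FracDeriv

variable {F : Type*} [NormedAddCommGroup F] [NormedSpace ℝ F]

/-- The normalising constant `c_{3,s} = s·4^s·Γ(3/2 + s)/(π^{3/2} Γ(1 − s))` of the hypersingular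
integral for `(−Δ)^s` on `ℝ³`, written for `|∇|^α = (−Δ)^{α/2}`, i.e. `s = α/2`
(Di Nezza–Palatucci–Valdinoci, §3: `(−Δ)^s u(x) = C(n,s) P.V.∫ (u(x)−u(y))|x−y|^{−n−2s} dy` with
`C(n,s)⁻¹ = ∫ (1 − cos ζ₁)|ζ|^{−n−2s} dζ`; the closed form is the classical value of that integral).
[cite: DinezzaPalatucciValdinoci2012, §3 eq. (3.1)–(3.2)] -/
def fracDerivConst (α : ℝ) : ℝ :=
  (α / 2) * 4 ^ (α / 2) * Real.Gamma (3 / 2 + α / 2) / (π ^ (3 / 2 : ℝ) * Real.Gamma (1 - α / 2))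

/-- The fractional derivative `|∇|^α v = (−Δ)^{α/2} v` of a field on `ℝ³`, hypersingular form
`c_{3,α/2} ∫ (v x − v y) ‖x − y‖^{−(3+α)} dy` (Di Nezza–Palatucci–Valdinoci §3, (3.2) and Prop. 3.3:
Fourier symbol `|ξ|^{α}`; Córdoba–Martínez-Zoroa–Zheng (1): "`|∇|^α g ≡ (−Δ)^{α/2} g`"). For
`0 < α < 1` and `v` bounded and Lipschitz the Bochner integral converges absolutely; outside that
regime (e.g. `1 ≤ α < 2`, where a principal value is needed) the value is junk. [cite: DinezzaPalatucciValdinoci2012, §3 eq. (3.2) and Prop. 3.3]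
[cite: CordobaMartinezzoroaZheng2024, §1 eq. (1) (p. 1 of arXiv:2407.06776)] -/
def fracDeriv (α : ℝ) (v : EuclideanSpace ℝ (Fin 3) → F) (x : EuclideanSpace ℝ (Fin 3)) : F :=
  fracDerivConst α • ∫ y, (‖x - y‖ ^ (3 + α))⁻¹ • (v x - v y)

/-- Unfolding `fracDeriv`. [cite: DinezzaPalatucciValdinoci2012, §3 eq. (3.2)] -/
theorem fracDeriv_apply (α : ℝ) (v : EuclideanSpace ℝ (Fin 3) → F) (x : EuclideanSpace ℝ (Fin 3)) :
    fracDeriv α v x = fracDerivConst α • ∫ y, (‖x - y‖ ^ (3 + α))⁻¹ • (v x - v y) :=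
  rfl

/-- `|∇|^α` kills constants (the integrand vanishes identically). [cite: DinezzaPalatucciValdinoci2012, §3 eq. (3.2)] -/
@[simp] theorem fracDeriv_const (α : ℝ) (c : F) :
    fracDeriv α (fun _ : EuclideanSpace ℝ (Fin 3) => c) = 0 := by
  funext x
  simp [fracDeriv]

/-- In particular `|∇|^α 0 = 0`. [cite: DinezzaPalatucciValdinoci2012, §3 eq. (3.2)] -/
@[simp] theorem fracDeriv_zero (α : ℝ) :
    fracDeriv α (0 : EuclideanSpace ℝ (Fin 3) → F) = 0 :=
  fracDeriv_const α (0 : F)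

end FracDeriv

/-! ### Classical solutions of the forced fractional Navier–Stokes system on `ℝ³ × S` -/

/-- Classical solutions of the forced incompressible **fractional** Navier–Stokes system
`∂ₜu + (u·∇)u + ∇P + ν|∇|^α u = f`, `div u = 0` on `ℝ³ × S` (Córdoba–Martínez-Zoroa–Zheng (1)),
in the shape of the tree's `IsClassicalNSSolutionOn` (`ClassicalSolution.lean`: `νΔu` there,
`−ν|∇|^α u` here): the velocity jointly `C^∞` on `S × ℝ³` (§4.3 p. 27 of the source: "the whole sum
is smooth in `(x,t) ∈ ℝ³ × [0,1)`"), the pressure `C¹` in space on every slice (nothing more is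
printed about it), the momentum equation pointwise with the one-sided time derivative
`timeDerivWithin S`, and incompressibility. [cite: CordobaMartinezzoroaZheng2024, §1 eq. (1) (p. 1); §4.3 (p. 27–28)] -/
structure IsClassicalFracNSSolutionOn (S : Set ℝ) (ν α : ℝ)
    (f u : ℝ → EuclideanSpace ℝ (Fin 3) → EuclideanSpace ℝ (Fin 3))
    (P : ℝ → EuclideanSpace ℝ (Fin 3) → ℝ) : Prop where
  /-- The velocity is jointly smooth on `S × ℝ³`. -/
  smooth_velocity : IsSmoothSpaceTimeOn S u
  /-- Every pressure slice is `C¹`. -/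
  contDiff_pressure : ∀ t ∈ S, ContDiff ℝ 1 (P t)
  /-- The momentum equation `∂ₜu + (u·∇)u + ∇P + ν|∇|^α u = f` pointwise on `S × ℝ³`. -/
  momentum : ∀ t ∈ S, ∀ x,
    timeDerivWithin S u t x + convect (u t) (u t) x + gradient (P t) x + ν • fracDeriv α (u t) x =
      f t x
  /-- Incompressibility `div u(t) = 0`, `t ∈ S`. -/
  divFree : ∀ t ∈ S, VectorCalculus.IsDivFree (u t)

namespace IsClassicalFracNSSolutionOn

variable {S : Set ℝ} {ν α : ℝ} {f u : ℝ → EuclideanSpace ℝ (Fin 3) → EuclideanSpace ℝ (Fin 3)}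
  {P : ℝ → EuclideanSpace ℝ (Fin 3) → ℝ}

/-- The slices of the velocity are smooth. [cite: CordobaMartinezzoroaZheng2024, Thm 1 (p. 2): "the velocity u is smooth in x"] -/
theorem contDiff_velocity (h : IsClassicalFracNSSolutionOn S ν α f u P) {t : ℝ} (ht : t ∈ S) :
    ContDiff ℝ ∞ (u t) :=
  h.smooth_velocity.contDiff_slice ht

/-- The force is determined by `(u, P)` as the residual of the equation (how the source produces
it, §4.3 p. 28). [cite: CordobaMartinezzoroaZheng2024, §4.3 (p. 28)] -/
theorem force_eq (h : IsClassicalFracNSSolutionOn S ν α f u P) {t : ℝ} (ht : t ∈ S)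
    (x : EuclideanSpace ℝ (Fin 3)) :
    f t x = timeDerivWithin S u t x + convect (u t) (u t) x + gradient (P t) x +
      ν • fracDeriv α (u t) x :=
  (h.momentum t ht x).symm

end IsClassicalFracNSSolutionOn

/-! ### The named fact -/

namespace CordobaMartinezZoroaZheng2024

/-- The printed threshold `α₀ = (22 − 8√7)/9 ≈ 0.0928`. [cite: CordobaMartinezzoroaZheng2024, Thm 1 (p. 2)] -/
def alpha0 : ℝ := (22 - 8 * Real.sqrt 7) / 9

/-- `α₀ > 0` (as printed: "`α₀ = (22−8√7)/9 > 0`"; indeed `8√7 = √448 < √484 = 22`). [cite: CordobaMartinezzoroaZheng2024, Thm 1 (p. 2)] -/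
theorem alpha0_pos : 0 < alpha0 := by
  unfold alpha0
  have h7 : Real.sqrt 7 < 11 / 4 := by
    rw [Real.sqrt_lt' (by norm_num)]
    norm_num
  linarith

/-- `α₀ < 1` (so the whole printed range lies in the absolutely convergent regime of `fracDeriv`;
indeed `8√7 > 13` since `448 > 169`). [cite: CordobaMartinezzoroaZheng2024, Thm 1 (p. 2)] -/
theorem alpha0_lt_one : alpha0 < 1 := by
  unfold alpha0
  have h7 : 13 / 8 < Real.sqrt 7 := by
    rw [Real.lt_sqrt (by norm_num)]
    norm_num
  linarith

/-- **Córdoba–Martínez-Zoroa–Zheng, Theorem 1 (arXiv:2407.06776 p. 2; ARMA 2026)**: "There is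
`α₀ = (22−8√7)/9 > 0` such that for any `α ∈ [0, α₀)`, there exist solutions of the forced 3D
incompressible fractional Navier-Stokes equations (1) in `ℝ³ × [0,1]` with `ν > 0` [footnote: "We
will actually show the theorem for `ν = 0.01`, but a rescaling argument shows the result for all
`ν > 0`"] and an external forcing which is in `L¹_t([0,1])C^{1,ε}_x ∩ L^∞_t L²_x` for some `ε > 0`,
such that the velocity `u ∈ L^∞_{t,x} ∩ L^∞_t L²_x`, and that on the time interval `0 ≤ t < 1`, the
velocity `u` is smooth in `x` and satisfies `lim_{t→1} ∫₀ᵗ |∇u(x,s)|_{L^∞} ds = ∞`." **Rendering**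
(module docstring; special case `0 < α`, `-- TODO(general form): α = 0 is the damped case
ν|∇|⁰ = ν·id, printed but not rendered`): for every `0 < α < α₀` and every `ν > 0` there are
`ε > 0`, a force `f`, a velocity `u` and a pressure `P` on `[0,1) × ℝ³` such that `(u, P)` is a
classical solution of `∂ₜu + (u·∇)u + ∇P + ν|∇|^α u = f`, `div u = 0` on `[0,1) × ℝ³`
(`IsClassicalFracNSSolutionOn (Ico 0 1)`), the force has `∫_{[0,1)} ‖f(t)‖_{C^{1,ε}(ℝ³)} dt < ∞` and
`sup_{t<1} ∫ |f(t)|² < ∞`, the velocity is bounded on `[0,1) × ℝ³` with `sup_{t<1} ∫|u(t)|² < ∞`, and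
`∫_{(0,t)} ‖∇u(s)‖_{L^∞} ds → ∞` as `t ↑ 1`. [cite: CordobaMartinezzoroaZheng2024, Thm 1 with footnote 1 and Remark 1 (p. 2 of arXiv:2407.06776); eq. (1) (p. 1); §4.3 (p. 27–28)] -/
def hypodissipativeForcedBlowup : Prop :=
  ∀ α : ℝ, 0 < α → α < alpha0 → ∀ ν : ℝ, 0 < ν →
    ∃ (ε : ℝ≥0) (f u : ℝ → EuclideanSpace ℝ (Fin 3) → EuclideanSpace ℝ (Fin 3))
      (P : ℝ → EuclideanSpace ℝ (Fin 3) → ℝ),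
      0 < ε ∧ IsClassicalFracNSSolutionOn (Ico 0 1) ν α f u P ∧
      -- the force: `L¹_t([0,1)) C^{1,ε}_x ∩ L^∞_t L²_x`
      (∫⁻ t in Ico (0 : ℝ) 1, FunctionSpaces.eContDiffHolderNorm 1 ε (f t)) < (⊤ : ℝ≥0∞) ∧
      (∃ E : ℝ≥0, ∀ t ∈ Ico (0 : ℝ) 1, eEnergy (f t) ≤ E) ∧
      -- the velocity: `L^∞_{t,x} ∩ L^∞_t L²_x`
      (∃ M : ℝ, ∀ t ∈ Ico (0 : ℝ) 1, ∀ x, ‖u t x‖ ≤ M) ∧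
      (∃ E : ℝ≥0, ∀ t ∈ Ico (0 : ℝ) 1, eEnergy (u t) ≤ E) ∧
      -- loss of regularity at `t = 1`: `∫₀ᵗ ‖∇u(s)‖_{L^∞} ds → ∞`
      Tendsto (fun t : ℝ => ∫⁻ s in Ioo 0 t, FunctionSpaces.eSupNorm (fderiv ℝ (u s)))
        (𝓝[<] 1) (𝓝 (⊤ : ℝ≥0∞))

/-- The divergence of `∫₀ᵗ ‖∇u‖_{L^∞}` as `t ↑ 1` forbids a uniform Lipschitz bound on `[0,1)`:
`sup_{t<1} ‖∇u(t)‖_{L^∞} = ∞` (the integral over `(0,t) ⊆ (0,1)` would stay below the bound).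
[cite: CordobaMartinezzoroaZheng2024, Thm 1 (p. 2) and Abstract ("loses regularity in finite time")] -/
theorem not_bddAbove_of_tendsto_lintegral
    {u : ℝ → EuclideanSpace ℝ (Fin 3) → EuclideanSpace ℝ (Fin 3)}
    (hT : Tendsto (fun t : ℝ => ∫⁻ s in Ioo 0 t, FunctionSpaces.eSupNorm (fderiv ℝ (u s)))
      (𝓝[<] 1) (𝓝 (⊤ : ℝ≥0∞)))
    (C : ℝ≥0) : ¬ ∀ t ∈ Ico (0 : ℝ) 1, FunctionSpaces.eSupNorm (fderiv ℝ (u t)) ≤ C := by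
  intro hC
  -- eventually the integral exceeds `C`, but it is at most `C · |(0,t)| ≤ C`
  have hev : ∀ᶠ t in 𝓝[<] (1 : ℝ),
      (C : ℝ≥0∞) < ∫⁻ s in Ioo 0 t, FunctionSpaces.eSupNorm (fderiv ℝ (u s)) :=
    hT.eventually (lt_mem_nhds ENNReal.coe_lt_top)
  have hwin : ∀ᶠ t in 𝓝[<] (1 : ℝ), t ∈ Ioo (0 : ℝ) 1 := Ioo_mem_nhdsLT zero_lt_one
  obtain ⟨t, ht, htw⟩ := (hev.and hwin).exists
  have hle : ∫⁻ s in Ioo 0 t, FunctionSpaces.eSupNorm (fderiv ℝ (u s)) ≤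
      (C : ℝ≥0∞) * volume (Ioo (0 : ℝ) t) :=
    (setLIntegral_mono' measurableSet_Ioo fun s hs => hC s ⟨hs.1.le, hs.2.trans htw.2⟩).trans_eq
      (setLIntegral_const _ _)
  have hvol : volume (Ioo (0 : ℝ) t) ≤ 1 := by
    rw [Real.volume_Ioo, sub_zero]
    exact ENNReal.ofReal_le_one.2 htw.2.le
  have : (C : ℝ≥0∞) * volume (Ioo (0 : ℝ) t) ≤ C := by
    simpa using mul_le_mul_right hvol (C : ℝ≥0∞)
  exact absurd (ht.trans_le (hle.trans this)) (lt_irrefl _)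

/-- From Theorem 1: for every `0 < α < α₀` and `ν > 0`, a classical solution of the forced
fractional system on `[0,1) × ℝ³` whose velocity gradient is NOT uniformly bounded on `[0,1)`
although the velocity itself is. [cite: CordobaMartinezzoroaZheng2024, Thm 1 (p. 2)] -/
theorem hypodissipativeForcedBlowup.gradient_unbounded (h : hypodissipativeForcedBlowup) {α ν : ℝ}
    (hα : 0 < α) (hα0 : α < alpha0) (hν : 0 < ν) :
    ∃ (f u : ℝ → EuclideanSpace ℝ (Fin 3) → EuclideanSpace ℝ (Fin 3))
      (P : ℝ → EuclideanSpace ℝ (Fin 3) → ℝ),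
      IsClassicalFracNSSolutionOn (Ico 0 1) ν α f u P ∧
      (∃ M : ℝ, ∀ t ∈ Ico (0 : ℝ) 1, ∀ x, ‖u t x‖ ≤ M) ∧
      ∀ C : ℝ≥0, ¬ ∀ t ∈ Ico (0 : ℝ) 1, FunctionSpaces.eSupNorm (fderiv ℝ (u t)) ≤ C := by
  obtain ⟨ε, f, u, P, -, hsol, -, -, hbd, -, hT⟩ := h α hα hα0 ν hν
  exact ⟨f, u, P, hsol, hbd, not_bddAbove_of_tendsto_lintegral hT⟩

end CordobaMartinezZoroaZheng2024

end Literature.Analysis.FluidPDE
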